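import Literature.NumberTheory.GaloisCohomology.Howard2004.TransverseCartesianProofs
import Literature.NumberTheory.GaloisCohomology.Howard2004.DVRSettingLevelTrivialityProofs
import Literature.NumberTheory.GaloisCohomology.Howard2004.CofinalEmbeddingColimitProofs
import Literature.NumberTheory.GaloisCohomology.Howard2004.DVRLevelRaisingInjectiveProofs
import Literature.NumberTheory.GaloisCohomology.Howard2004.DVRLevelLiftabilityProofs
import Literature.NumberTheory.GaloisCohomology.Howard2004.DVRSettingPiRefinement
import Literature.NumberTheory.GaloisCohomology.Howard2004.PropagateTowerProofs
import Literature.NumberTheory.GaloisCohomology.RestrictedRamificationUnramifiedClasses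
import Literature.NumberTheory.GaloisRepresentations.LocalGlobalCohomologyProofs
import HarnessLib

/-!
# Howard 2004, §1.4 display (1) on a `DVRSetting`: the local conditions `𝓕(n)` are CARTESIAN along any pinned
# transition `T^{(i)} ↪ T^{(j)}` at EVERY place, through several levels (proofs file)

Topic `NumberTheory/GaloisCohomology/Howard2004` (cell `pub/bsd-print-x9`, the cone of the cite-only leaf C45.1′/C45.1″
= Howard Prop. 1.4.1 / Flach; brick «C451-F0′ = LEVEL-EXACT», the `ι⁻¹` half; seat `bsd-line-x10b-p1-w2` g18; companion of
`DVRSettingLevelConditionsCocartesianProofs` = the `π` half).  THEOREMS ONLY: no definition, no named fact, no instance, no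
notation, no `sorry`.

SOURCE.  B. Howard, *The Heegner point Kolyvagin system*, Compositio Math. **140** (2004) = arXiv:1202.6340, §1.4 display (1)
(p. 8 L22–30): «`0 → H¹_{/𝓕}(K_v, T/𝔪^tT) →ξ H¹_{/𝓕}(K_v, T/𝔪^{s+t}T) → H¹_{/𝓕}(K_v, T/𝔪^sT)`», i.e. the local condition
of `𝓕` on `T/𝔪^tT` is the pre-image of the one on `T/𝔪^{s+t}T` under `ξ = π^s` (Morgan–Smith arXiv:2103.08530: «`ι⁻¹(𝒲) =
𝒲₁`»); for `(T^{(k)}, 𝓕(n))`, `n ∈ 𝓝^{(k)}`, via Lemma 1.5.1 (p. 9 L127–133) and H.3 (p. 7 L65–67, L116–118).  The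
ONE-STEP identity is the tree's `DVRSetting.comap_incLoc_atLevel_cond_eq` (`TransverseCartesianProofs`); here it is
iterated and transported to an ABSTRACT pinned transition with literal indices `(i, j)` (the presentation currency of the
cell's LIFT-PT criterion, where `ι : N 0 → N (t+1)` must not land in level `0 + (t+1)`).

* `DVRSetting.comap_incLocIter_atLevel_cond_eq` — `(𝓕(n)_{j+d,v}).comap (incLocIter j v d) = 𝓕(n)_{j,v}` (levels `≤ m`,
  `n ⊆ 𝓛^{(m)}`, every place; no unit hypothesis).
* `DVRSetting.exists_linearMap_comp_redLE_eq` — a PINNED transition `ι : T^{(i)} → T^{(j)}` (`R`-linear, equivariant,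
  `ι ∘ redLE = π^{e_j − e_i}`) exists for `i ≤ j` (re-indexing of `AdicTower.exists_linearMap_incH1LE_eq`);
  `injective_of_comp_redLE_eq`; `redLE_eq_zero_iff_mem_range_of_comp_redLE_eq` — `range ι = ker (T^{(j)} ↠ T^{(i')})` when
  `e_i + e_{i'} = e_j` (the module-level short exact sequence `0 → T^{(i)} → T^{(j)} → T^{(i')} → 0`).
* **`DVRSetting.comap_cohomologyMap_atLevel_cond_eq_of_comp_redLE_eq`** / `cohomologyMap_mem_atLevel_cond_iff_of_comp_redLE_eq`
  — for ANY pinned `ι`: `(𝓕(n)_{j,v}).comap H¹_v(ι) = 𝓕(n)_{i,v}`, i.e. `H¹_v(ι) m ∈ 𝓕(n)_{j,v} ↔ m ∈ 𝓕(n)_{i,v}` (the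
  cartesian letter `hιF`).

* §4 (append) the finite exceptional set: `exists_finset_forall_localization_mem_atLevel_cond` (a global class lies in
  `𝓕(n)_{j,v}` off a finite `Sfin ⊇ Σ(𝓕) ∪ n`, Milne I 4.8), `isUnramifiedOutside_atLevel_cond_of_subset` — the letters `Sfin`/`hout`/`hFS` of the cell's LIFT-PT (`hSp` is the tree's
  `DVRSettingEngineLocalInputsProofs.not_mem_and_isUnramifiedAt_of_not_mem_Sigma`).

HONEST FRAMING.  Pairing-free plumbing; Prop. 1.4.1, C45.1′/C45.1″, `thm161_dvrKolyvaginBound` are NOT proved; no summit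
statement is proved; BSD is not proved by any of this.

References: [Howard2004HeegnerKolyvagin] §1.4 display (1), Lemma 1.3.3, Lemma 1.5.1, H.3, §1.6 (arXiv:1202.6340 p. 7
L65–67 and L152–160, p. 8 L22–30, p. 9 L127–133, p. 11 L18–20 and L33–44, p. 12 L36–48); [MazurRubinMemoirs2004] Lemma 3.5.4,
Lemma 3.7.4; [SerreGaloisCohomology1997] I §2.2.
-/

set_option autoImplicit false

noncomputable section

open Function NumberField IsDedekindDomain IsDedekindDomain.HeightOneSpectrum Field
open scoped NumberField

namespace Literature.NumberTheory.GaloisCohomology.Howard2004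

open Literature.NumberTheory.GaloisRepresentations
open Literature.NumberTheory.GaloisRepresentations.DiscreteGaloisModule

namespace DVRSetting

variable {p : ℕ} [Fact p.Prime] {K : Type} [Field K] [NumberField K]
  {R : Type} [CommRing R] [IsDomain R] [IsDiscreteValuationRing R] [Algebra ℤ_[p] R]
  {N : ℕ → Type} [∀ k, AddCommGroup (N k)] [∀ k, TopologicalSpace (N k)]
  [∀ k, DiscreteTopology (N k)] [∀ k, Module R (N k)]
  {Rk : ℕ → Type} [∀ k, CommRing (Rk k)] [∀ k, IsLocalRing (Rk k)] [∀ k, TopologicalSpace (Rk k)]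
  [∀ k, DiscreteTopology (Rk k)] [∀ k, Algebra ℤ_[p] (Rk k)] [∀ k, Algebra R (Rk k)]
  [∀ k, Module (Rk k) (N k)] [∀ k, IsScalarTower R (Rk k) (N k)]
  {Nbar : Type} [AddCommGroup Nbar] [TopologicalSpace Nbar] [DiscreteTopology Nbar]
  [∀ k, Module (Rk k) Nbar]
  {Nq : ℕ → Finset (HeightOneSpectrum (𝓞 K)) → Type} [∀ k n, AddCommGroup (Nq k n)]
  [∀ k n, TopologicalSpace (Nq k n)] [∀ k n, DiscreteTopology (Nq k n)]
  [∀ k n, Module (Rk k) (Nq k n)] [∀ k n, Module R (Nq k n)]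
  [∀ k n, IsScalarTower R (Rk k) (Nq k n)]

/-! ## §1 The iterated transition; §2 pinned transitions; §3 the cartesian letter -/

/-- **`𝓕(n)` is cartesian along the iterated transition `H¹(K_v, T^{(j)}) → H¹(K_v, T^{(j+d)})`** (`incLocIter`, every
place, levels `≤ m`, `n ⊆ 𝓛^{(m)}`): `(𝓕(n)_{j+d,v}).comap (incLocIter j v d) = 𝓕(n)_{j,v}` — the one-step identity
`comap_incLoc_atLevel_cond_eq` iterated (H.3 on `Σ(𝓕)`, unramified-cartesian off it, transverse-cartesian at `λ ∈ n`).
[cite: Howard2004HeegnerKolyvagin, §1.4 display (1), Lemma 1.3.3, Lemma 1.5.1 (arXiv:1202.6340 p. 8 L22–30, p. 7 L152–160, p. 9 L127–133)]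
[cite: MazurRubinMemoirs2004, Lemma 3.7.4] -/
theorem comap_incLocIter_atLevel_cond_eq (S : DVRSetting p K R N Rk Nbar Nq) (hy : S.SatisfiesH)
    (hπm : S.π ∈ IsLocalRing.maximalIdeal R) (hle : ∀ k, S.e k ≤ S.e (k + 1))
    (n : Finset (HeightOneSpectrum (𝓞 K))) {m : ℕ} (hn : ↑n ⊆ S.levelPrimes m) (j : ℕ) (v : Place K) :
    ∀ d : ℕ, j + d ≤ m →
      (((S.t (j + d)).atLevel S.jbar n).cond v).comap
          (AdicTower.incLocIter S.T S.π S.e hy.killed hy.ker_red hπm hle j v d) =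
        ((S.t j).atLevel S.jbar n).cond v
  | 0, _ => by
    ext c
    rfl
  | d + 1, hd => by
    have ih := comap_incLocIter_atLevel_cond_eq S hy hπm hle n hn j v d (by omega)
    have hstep := S.comap_incLoc_atLevel_cond_eq hy hπm hle (j + d) n
      (S.htriv_of_subset_levelPrimes hy hn (j + d + 1) (by omega)) v
    change (((S.t (j + d + 1)).atLevel S.jbar n).cond v).comap
        ((AdicTower.incLoc S.T S.π S.e hy.killed hy.ker_red hπm hle (j + d) v).comp
          (AdicTower.incLocIter S.T S.π S.e hy.killed hy.ker_red hπm hle j v d)) = _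
    rw [← AddSubgroup.comap_comap, hstep, ih]

/-- **A pinned module-level transition `ι : T^{(i)} → T^{(j)}` EXISTS with clean indices** (`i ≤ j`): `R`-linear,
`Γ_K`-equivariant, with `ι ∘ redLE = π^{e_j − e_i}` (which determines it: `redLE` is onto) — the tree's
`AdicTower.exists_linearMap_incH1LE_eq` re-indexed from `(j, j + D)` to `(i, j)`.
[cite: Howard2004HeegnerKolyvagin, §1.6 (arXiv:1202.6340 p. 11 L18–20, p. 12 L40–48)] -/
theorem exists_linearMap_comp_redLE_eq (S : DVRSetting p K R N Rk Nbar Nq) (hy : S.SatisfiesH)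
    (hπm : S.π ∈ IsLocalRing.maximalIdeal R) (hle : ∀ k, S.e k ≤ S.e (k + 1)) {i j : ℕ} (hij : i ≤ j) :
    ∃ (ι : N i →ₗ[R] N j) (_ : ∀ (g : absoluteGaloisGroup K) (x : N i), ι (S.T.ρ i g x) = S.T.ρ j g (ι x)),
      ∀ y : N j, ι (S.T.redLE hij y) = S.π ^ (S.e j - S.e i) • y := by
  obtain ⟨d, rfl⟩ := Nat.exists_eq_add_of_le hij
  obtain ⟨φ, hφ, hφred, -, -⟩ := AdicTower.exists_linearMap_incH1LE_eq S.T S.π S.e hy.killed hy.ker_red hπm hle i d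
  exact ⟨φ, hφ, fun y => by rw [AdicTower.redLE_eq_redIter, hφred]⟩

/-- **A pinned transition is injective** (`ι (redLE y) = π^{e_j−e_i} y = 0` forces `y ∈ π^{e_i} T^{(j)} = ker redLE`,
H.0 on level `j`). [cite: Howard2004HeegnerKolyvagin, Lemma 1.3.3 and §1.6 (arXiv:1202.6340 p. 7 L152–160, p. 12 L36–46)] -/
theorem injective_of_comp_redLE_eq (S : DVRSetting p K R N Rk Nbar Nq) (hy : S.SatisfiesH) {i j : ℕ} (hij : i ≤ j)
    (ι : N i →ₗ[R] N j) (hι : ∀ y : N j, ι (S.T.redLE hij y) = S.π ^ (S.e j - S.e i) • y) :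
    Function.Injective ι := by
  haveI := (hy.h0 j).1
  have hπm : S.π ∈ IsLocalRing.maximalIdeal R := by rw [hy.unif]; exact Ideal.mem_span_singleton_self _
  have heij : S.e i ≤ S.e j := hy.e_strictMono.monotone hij
  refine (injective_iff_map_eq_zero _).2 fun x hx => ?_
  obtain ⟨y, rfl⟩ := S.T.redLE_surjective hij x
  rw [hι] at hx
  obtain ⟨y', rfl⟩ := LevelRaising.exists_eq_pow_smul_of_pow_smul_eq_zero S.π (S.π_ne_zero hy) (S.e j)
    (hy.algebraMap_surjective j) (S.ker_algebraMap_le hy j) (Nat.sub_le _ _) y hx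
  rw [Nat.sub_sub_self heij, map_smul]
  exact hy.killed i _ (Ideal.pow_mem_pow hπm _) _

/-- **The range of a pinned transition is a reduction kernel**: for `i, i' ≤ j` with `e_i + e_{i'} = e_j`,
`range (ι : T^{(i)} ↪ T^{(j)}) = ker (redLE : T^{(j)} ↠ T^{(i')}) = π^{e_{i'}} T^{(j)}` — the short exact sequence
`0 → T^{(i)} → T^{(j)} → T^{(i')} → 0` of the tower at the module level (on a full tower: `0 → T/𝔪^{i+1} →
T/𝔪^{t+2} → T/𝔪^{t+1} → 0` with `i + 1 + (t + 1) = t + 2`).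
[cite: Howard2004HeegnerKolyvagin, §1.4 displays (1)(2) and §1.6 (arXiv:1202.6340 p. 8 L22–30, p. 11 L33–38)] -/
theorem redLE_eq_zero_iff_mem_range_of_comp_redLE_eq (S : DVRSetting p K R N Rk Nbar Nq) (hy : S.SatisfiesH)
    {i i' j : ℕ} (hij : i ≤ j) (hi'j : i' ≤ j) (he : S.e i + S.e i' = S.e j)
    (ι : N i →ₗ[R] N j) (hι : ∀ y : N j, ι (S.T.redLE hij y) = S.π ^ (S.e j - S.e i) • y) (z : N j) :
    S.T.redLE hi'j z = 0 ↔ ∃ x, ι x = z := by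
  have hsub : S.e j - S.e i = S.e i' := by omega
  rw [← LinearMap.mem_ker, S.ker_redLE hy hi'j, S.maximalIdeal_pow_eq_span_pow hy,
    Submodule.ideal_span_singleton_smul, Submodule.mem_smul_pointwise_iff_exists]
  constructor
  · rintro ⟨y, -, rfl⟩
    exact ⟨S.T.redLE hij y, by rw [hι, hsub]⟩
  · rintro ⟨x, rfl⟩
    obtain ⟨y, rfl⟩ := S.T.redLE_surjective hij x
    exact ⟨y, Submodule.mem_top, by rw [hι, hsub]⟩

/-- **`𝓕(n)` is cartesian along ANY pinned transition `ι : T^{(i)} → T^{(j)}`** (`ι ∘ redLE = π^{e_j−e_i}`; `i ≤ j`,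
`n ⊆ 𝓛^{(j)}`, EVERY place, NO unit hypothesis): `(𝓕(n)_{j,v}).comap H¹_v(ι) = 𝓕(n)_{i,v}` — Howard §1.4 display (1)
read `T`-side (Morgan–Smith «`ι⁻¹(𝒲) = 𝒲₁`»), in the abstract-presentation currency of the cell's LIFT-PT (`ι` with
indices `(0, t+1)` literal rather than `0 + (t+1)`).  Proof: `ι` IS the tower's iterated transition
(`exists_linearMap_incH1LE_eq`: same pinning, `redLE` onto), whose `H¹_v` is `incLocIter`; then `comap_incLocIter_atLevel_cond_eq`.
[cite: Howard2004HeegnerKolyvagin, §1.4 display (1), Lemma 1.3.3, Lemma 1.5.1 (arXiv:1202.6340 p. 8 L22–30, p. 7 L152–160, p. 9 L127–133)]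
[cite: MazurRubinMemoirs2004, Lemma 3.7.4] -/
theorem comap_cohomologyMap_atLevel_cond_eq_of_comp_redLE_eq (S : DVRSetting p K R N Rk Nbar Nq)
    (hy : S.SatisfiesH) {i j : ℕ} (hij : i ≤ j) {n : Finset (HeightOneSpectrum (𝓞 K))}
    (hn : ↑n ⊆ S.levelPrimes j) (ι : N i →ₗ[R] N j)
    (hιg : ∀ (g : absoluteGaloisGroup K) (x : N i), ι (S.T.ρ i g x) = S.T.ρ j g (ι x))
    (hι : ∀ y : N j, ι (S.T.redLE hij y) = S.π ^ (S.e j - S.e i) • y) (v : Place K) :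
    (((S.t j).atLevel S.jbar n).cond v).comap
        (ContinuousRep.cohomologyMap ((S.T.ρ i).toLocal v) ((S.T.ρ j).toLocal v) ι.toAddMonoidHom
          continuous_of_discreteTopology (fun _ x => hιg _ x) 1) =
      ((S.t i).atLevel S.jbar n).cond v := by
  have hπm : S.π ∈ IsLocalRing.maximalIdeal R := by rw [hy.unif]; exact Ideal.mem_span_singleton_self _
  have hle : ∀ k, S.e k ≤ S.e (k + 1) := fun k => (hy.e_strictMono (Nat.lt_succ_self k)).le
  obtain ⟨d, rfl⟩ := Nat.exists_eq_add_of_le hij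
  obtain ⟨φ, hφ, hφred, -, hφloc⟩ :=
    AdicTower.exists_linearMap_incH1LE_eq S.T S.π S.e hy.killed hy.ker_red hπm hle i d
  have hιφ : ∀ x, ι.toAddMonoidHom x = φ.toAddMonoidHom x := fun x => by
    obtain ⟨y, rfl⟩ := S.T.redLE_surjective hij x
    change ι (S.T.redLE hij y) = φ (S.T.redLE hij y)
    rw [hι, AdicTower.redLE_eq_redIter, hφred]
  have hmap : ∀ c, ContinuousRep.cohomologyMap ((S.T.ρ i).toLocal v) ((S.T.ρ (i + d)).toLocal v) ι.toAddMonoidHom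
      continuous_of_discreteTopology (fun _ x => hιg _ x) 1 c =
        AdicTower.incLocIter S.T S.π S.e hy.killed hy.ker_red hπm hle i v d c := fun c => by
    rw [hφloc]
    exact cohomologyMap_one_congr_apply ((S.T.ρ i).toLocal v) ((S.T.ρ (i + d)).toLocal v) ι.toAddMonoidHom
      φ.toAddMonoidHom (fun _ x => hιg _ x) (fun _ x => hφ _ x) hιφ c
  have hfun : (ContinuousRep.cohomologyMap ((S.T.ρ i).toLocal v) ((S.T.ρ (i + d)).toLocal v) ι.toAddMonoidHom
      continuous_of_discreteTopology (fun _ x => hιg _ x) 1 :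
        galoisCohomology ((S.T.ρ i).toLocal v) 1 →+ galoisCohomology ((S.T.ρ (i + d)).toLocal v) 1) =
      AdicTower.incLocIter S.T S.π S.e hy.killed hy.ker_red hπm hle i v d := AddMonoidHom.ext hmap
  exact (congrArg (fun f => AddSubgroup.comap f (((S.t (i + d)).atLevel S.jbar n).cond v)) hfun).trans
    (S.comap_incLocIter_atLevel_cond_eq hy hπm hle n hn i v d le_rfl)

/-- The same as a membership criterion (the cartesian letter `hιF` of the cell's LIFT-PT):
`H¹_v(ι) m ∈ 𝓕(n)_{j,v} ↔ m ∈ 𝓕(n)_{i,v}`.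
[cite: Howard2004HeegnerKolyvagin, §1.4 display (1) (arXiv:1202.6340 p. 8 L22–30)] -/
theorem cohomologyMap_mem_atLevel_cond_iff_of_comp_redLE_eq (S : DVRSetting p K R N Rk Nbar Nq)
    (hy : S.SatisfiesH) {i j : ℕ} (hij : i ≤ j) {n : Finset (HeightOneSpectrum (𝓞 K))}
    (hn : ↑n ⊆ S.levelPrimes j) (ι : N i →ₗ[R] N j)
    (hιg : ∀ (g : absoluteGaloisGroup K) (x : N i), ι (S.T.ρ i g x) = S.T.ρ j g (ι x))
    (hι : ∀ y : N j, ι (S.T.redLE hij y) = S.π ^ (S.e j - S.e i) • y) (v : Place K)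
    (m : galoisCohomology ((S.T.ρ i).toLocal v) 1) :
    ContinuousRep.cohomologyMap ((S.T.ρ i).toLocal v) ((S.T.ρ j).toLocal v) ι.toAddMonoidHom
        continuous_of_discreteTopology (fun _ x => hιg _ x) 1 m ∈ ((S.t j).atLevel S.jbar n).cond v ↔
      m ∈ ((S.t i).atLevel S.jbar n).cond v := by
  exact AddSubgroup.ext_iff.mp (S.comap_cohomologyMap_atLevel_cond_eq_of_comp_redLE_eq hy hij hn ι hιg hι v) m

/-! ## §4 (append) The finite exceptional set of a global class: the letters `Sfin`, `hout`, `hFS`, `hSp` of LIFT-PT -/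

/-- **A global class lies in `𝓕(n)_{j,v}` at all but finitely many places.**  For `c ∈ H¹(K, T^{(j)})` there is a finite
set of places `Sfin ⊇ Σ(𝓕) ∪ n` with `loc_v c ∈ 𝓕(n)_{j,v}` for every `v ∉ Sfin`: off `Σ(𝓕) ∪ n` the condition is the
unramified one (Def. 1.1.10), `T^{(j)}` is unramified (`Σ(𝓕)` contains its ramified places), and a class of `H¹(K, M)` is
unramified at all but finitely many `v` (Milne I Lemma 4.8: `localization_eq_zero_cofinite_holds` +
`mem_range_restrictedInf_iff_forall_localization_mem_unramifiedSubgroup`).  This is the letter `hout` (with `Sfin`) of the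
cell's LIFT-PT `exists_localDefects_of_forall_exists_redLELoc_eq`; no hypothesis on the setting.
[cite: Howard2004HeegnerKolyvagin, Def. 1.1.10 and §1.4 (arXiv:1202.6340 p. 6 L10–24, p. 8 L60–80: G_S-cochains)]
[cite: MilneADT2006, Ch. I §4, Lemma 4.8] -/
theorem exists_finset_forall_localization_mem_atLevel_cond (S : DVRSetting p K R N Rk Nbar Nq) (j : ℕ)
    (n : Finset (HeightOneSpectrum (𝓞 K))) (c : galoisCohomology (S.T.ρ j) 1) :
    ∃ Sfin : Finset (Place K), (S.t j).Sigma ⊆ Sfin ∧ (∀ w ∈ n, (Sum.inr w : Place K) ∈ Sfin) ∧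
      ∀ v ∉ Sfin, galoisCohomology.localization (S.T.ρ j) v 1 c ∈ ((S.t j).atLevel S.jbar n).cond v := by
  classical
  have hcof : ∀ᶠ v : HeightOneSpectrum (𝓞 K) in Filter.cofinite, galoisCohomology.IsUnramifiedAt v c :=
    (localization_eq_zero_cofinite_holds (K := K) (M := N j)) (S.T.ρ j) c
  rw [Filter.eventually_cofinite] at hcof
  set B : Finset (HeightOneSpectrum (𝓞 K)) := hcof.toFinset with hB
  let Sset : Set (HeightOneSpectrum (𝓞 K)) := {v | (Sum.inr v : Place K) ∈ (S.t j).Sigma} ∪ ↑B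
  have hur : GaloisRep.IsUnramifiedOutside Sset (S.T.ρ j) := fun v hv => by
    by_contra h
    exact hv (Or.inl ((S.t j).isHoward.mem_of_ramified v h))
  have hc : ∀ v ∉ Sset, galoisCohomology.IsUnramifiedAt v c := fun v hv => by
    by_contra h
    exact hv (Or.inr (Finset.mem_coe.2 (hcof.mem_toFinset.2 h)))
  have hrange := (DiscreteGaloisModule.mem_range_restrictedInf_iff_forall_isUnramifiedAt (S.T.ρ j) hur c).2 hc
  have hloc := (DiscreteGaloisModule.mem_range_restrictedInf_iff_forall_localization_mem_unramifiedSubgroup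
    (S.T.ρ j) hur c).1 hrange
  refine ⟨(S.t j).Sigma ∪ (n.image Sum.inr ∪ B.image Sum.inr), Finset.subset_union_left, fun w hw => ?_,
    fun v hv => ?_⟩
  · exact Finset.mem_union_right _ (Finset.mem_union_left _ (Finset.mem_image_of_mem _ hw))
  · rcases v with w | w
    · exact absurd (Finset.mem_union_left _ ((S.t j).isHoward.isUnramifiedOutside.1 w)) hv
    · have hwSig : (Sum.inr w : Place K) ∉ (S.t j).Sigma := fun h => hv (Finset.mem_union_left _ h)
      have hwn : w ∉ n := fun h =>
        hv (Finset.mem_union_right _ (Finset.mem_union_left _ (Finset.mem_image_of_mem _ h)))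
      have hwB : w ∉ B := fun h =>
        hv (Finset.mem_union_right _ (Finset.mem_union_right _ (Finset.mem_image_of_mem _ h)))
      rw [(S.t j).atLevel_cond_inr_of_not_mem S.jbar hwn, (S.t j).isHoward.isUnramifiedOutside.2 w hwSig]
      exact hloc w fun h => h.elim (fun h1 => hwSig h1) fun h2 => hwB (Finset.mem_coe.1 h2)

/-- **`𝓕(n)` on `T^{(j)}` is unramified outside any `Sfin ⊇ Σ(𝓕) ∪ n`** (Def. 1.1.10 / Def. 1.2.2: `Σ(𝓕(n)) = Σ(𝓕) ∪ {λ ∣ n}`;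
the letter `hFS` of the cell's LIFT-PT). [cite: Howard2004HeegnerKolyvagin, Def. 1.1.10 and Def. 1.2.2 (arXiv:1202.6340 p. 6 L10–24, L101–125)] -/
theorem isUnramifiedOutside_atLevel_cond_of_subset (S : DVRSetting p K R N Rk Nbar Nq) (j : ℕ)
    (n : Finset (HeightOneSpectrum (𝓞 K))) {Sfin : Finset (Place K)} (hSig : (S.t j).Sigma ⊆ Sfin)
    (hn : ∀ w ∈ n, (Sum.inr w : Place K) ∈ Sfin) :
    (((S.t j).atLevel S.jbar n).cond).IsUnramifiedOutside Sfin := by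
  refine ⟨fun w => hSig ((S.t j).isHoward.isUnramifiedOutside.1 w), fun w hw => ?_⟩
  have hwn : w ∉ n := fun h => hw (hn w h)
  rw [(S.t j).atLevel_cond_inr_of_not_mem S.jbar hwn]
  exact (S.t j).isHoward.isUnramifiedOutside.2 w fun h => hw (hSig h)

end DVRSetting

end Literature.NumberTheory.GaloisCohomology.Howard2004

end
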